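import Mathlib.RepresentationTheory.Basic
import Mathlib.LinearAlgebra.Matrix.ToLinearEquiv
import Mathlib.LinearAlgebra.Determinant
import Mathlib.Data.Fin.VecNotation
import Mathlib.Data.List.Chain
import Mathlib.Tactic.LinearCombination
import Literature.AlgebraicGeometry.HodgeTheory.LocallyTrivialExtensionClasses

/-!
# Route LinearSystemTorelli — crux `LocalTubeSpan`: the thin configuration — lemmas for the ping-pong dynamics

Helper file (`--supports stmt-HodgeConjecture-2490`, line `Sketch`; the elementary lemmas consumed by
the companion file `LinearSystemTorelliLocalTubeSpanThinDynamics` = stub `stub_thinDynamics`, the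
cycle-3 hardest stub, taken by the line lead).  The crux ("local Schnell theorem", C. Schnell,
*Primitive cohomology and the tube mapping*, Math. Z. 268 (2010) §3, §7) asks that Schnell's third
map `H¹(G, V) → ∏_g V/(g - 1)V` be injective for LOCAL monodromy groups acting by Picard–Lefschetz
transvections; Schnell's Prop. 12 proves this when the cycles form a skew-symmetric vanishing lattice
(W. Janssen, Math. Ann. 266 (1983)).  The line's THIN BOUNDARY shows the statement is false for
general integral symplectic transvection configurations: on `V = ℚ²` with `B₀(x, y) = 4(x₀y₁ - x₁y₀)`
the transvections along `δ₁ = (1,0)`, `δ₂ = (0,1)`, `δ₃ = (1,1)` are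
`T₁(v) = (v₀ + 4v₁, v₁)`, `T₂(v) = (v₀, v₁ - 4v₀)`, `T₃(v) = v - 4(v₀ - v₁)(1,1)`, and they play
ping-pong on the three cones `C₁ = {2|v₁| ≤ |v₀|}`, `C₂ = {2|v₀| ≤ |v₁|}`,
`C₃ = {4|v₀ - v₁| ≤ |v₀ + v₁|}` (pairwise meeting in `0` only; `T_i^n`, `n ≠ 0`, maps the complement
of the interior of `C_i` into `C_i`).

Contents: `…_abs_le_abs_of_forall_nat` (closedness of a cone inequality under `n → ∞`),
`…_sq_eq_zero_of_det_fin_two` (a `2 × 2` matrix of determinant one with a fixed vector is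
unipotent), `…_one_add_pow_of_sq_zero` (`(1 + N)^n = 1 + nN`), `…_abs_le_abs_add_of_le` (the
triangle-inequality step of ping-pong), `…_thinCones_disjoint₀₁/₀₂/₁₂` (two different cones meet in
`0`), `…_thin_transvectionData` (the formula `ρ((τ i)^n) v = v - n ℓ_i(v) d_i` for all integers `n`),
`…_thin_det_eq_one` (determinant one on the group generated by the `τ i`).

No named facts; pure linear algebra over `ℚ`.

References: [Schnell2010] C. Schnell, Primitive cohomology and the tube mapping, Math. Z. 268
(2010) §7 (Prop. 12, and the Example of a non-injective restriction map); the ping-pong lemma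
(folklore, e.g. Lyndon–Schupp, Combinatorial Group Theory, III.12).
-/

-- `Summit.HodgeConjecture.HodgeConjecture.Theorems` is the mandated namespace (single-conjunct summit:
-- Sub = Summit), which `linter.dupNamespace` flags on every declaration; the lakefile turns the
-- linter off tree-wide (weak option), restated here so stand-alone elaboration is warning-free too.
set_option linter.dupNamespace false

noncomputable section

open Matrix

namespace Summit.HodgeConjecture.HodgeConjecture.Theorems

/-! ### Three elementary lemmas -/

/-- **Cone inequalities are closed under `n → ∞`.**  If `|x + n y| ≤ |x' + n y'|` for every
`n ≥ 1` then `|y| ≤ |y'|` (divide by `n`). [folklore] -/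
theorem localTubeSpan_abs_le_abs_of_forall_nat {x y x' y' : ℚ}
    (h : ∀ n : ℕ, 1 ≤ n → |x + n * y| ≤ |x' + n * y'|) : |y| ≤ |y'| := by
  by_contra hlt
  rw [not_le] at hlt
  have hpos : 0 < |y| - |y'| := sub_pos.2 hlt
  obtain ⟨n, hn⟩ := exists_nat_gt ((|x| + |x'|) / (|y| - |y'|))
  have hn' : |x| + |x'| < n * (|y| - |y'|) := (div_lt_iff₀ hpos).1 hn
  have key := h (n + 1) (Nat.le_add_left 1 n)
  -- `(n + 1)|y| - |x| ≤ |x + (n + 1) y| ≤ |x' + (n + 1) y'| ≤ |x'| + (n + 1)|y'|`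
  have e1 : |((n + 1 : ℕ) : ℚ) * y| ≤ |x + ((n + 1 : ℕ) : ℚ) * y| + |x| := by
    have := abs_add_le (x + ((n + 1 : ℕ) : ℚ) * y) (-x)
    rwa [add_neg_cancel_comm, abs_neg] at this
  have e2 : |x' + ((n + 1 : ℕ) : ℚ) * y'| ≤ |x'| + |((n + 1 : ℕ) : ℚ) * y'| := abs_add_le _ _
  rw [abs_mul, Nat.abs_cast] at e1 e2
  push_cast at e1 e2 key
  have e3 : ((n : ℚ) + 1) * (|y| - |y'|) ≤ |x| + |x'| := by rw [mul_sub]; linarith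
  have e4 : ((n : ℚ) + 1) * (|y| - |y'|) < n * (|y| - |y'|) := e3.trans_lt hn'
  rw [add_mul, one_mul] at e4
  linarith

/-- **A `2 × 2` matrix of determinant one with eigenvalue one is unipotent**: if `det M = 1` and
`det (M - 1) = 0` then `(M - 1)² = 0` (Cayley–Hamilton: the trace is `2`). [folklore] -/
theorem localTubeSpan_sq_eq_zero_of_det_fin_two (M : Matrix (Fin 2) (Fin 2) ℚ) (hdet : M.det = 1)
    (hdet1 : (M - 1).det = 0) : (M - 1) * (M - 1) = 0 := by
  rw [Matrix.det_fin_two] at hdet hdet1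
  simp only [Matrix.sub_apply, Matrix.one_apply_eq, ne_eq, zero_ne_one, not_false_eq_true,
    Matrix.one_apply_ne, one_ne_zero, sub_zero] at hdet1
  have htr : M 0 0 + M 1 1 = 2 := by linear_combination hdet - hdet1
  ext i j
  fin_cases i <;> fin_cases j <;>
    simp only [Matrix.mul_apply, Fin.sum_univ_two, Matrix.sub_apply, Matrix.one_apply_eq, ne_eq,
      zero_ne_one, one_ne_zero, not_false_eq_true, Matrix.one_apply_ne, sub_zero, Matrix.zero_apply,
      Fin.zero_eta, Fin.mk_one, Fin.isValue]
  · linear_combination (M 0 0) * htr - hdet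
  · linear_combination (M 0 1) * htr
  · linear_combination (M 1 0) * htr
  · linear_combination (M 1 1) * htr - hdet

/-- **Powers of a unipotent of index two**: `N² = 0` implies `(1 + N)^n = 1 + n N` in the
endomorphism ring. [folklore] -/
theorem localTubeSpan_one_add_pow_of_sq_zero {V : Type} [AddCommGroup V] [Module ℚ V]
    (N : Module.End ℚ V) (hN : N * N = 0) (n : ℕ) : (1 + N) ^ n = 1 + (n : ℚ) • N := by
  induction n with
  | zero => simp
  | succ n ih =>
    rw [pow_succ, ih]
    simp only [add_mul, mul_add, one_mul, mul_one, smul_mul_assoc, hN, smul_zero, add_zero,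
      Nat.cast_succ, add_smul, one_smul]
    abel

/-! ### Ping-pong arithmetic -/

/-- The triangle-inequality step of ping-pong: `|k| ≥ 2c|u|` and `|s| ≤ c|u|` give
`|s + k| ≥ c|u|`. [folklore] -/
theorem localTubeSpan_abs_le_abs_add_of_le (s k c u : ℚ) (hk : 2 * c * |u| ≤ |k|)
    (hs : |s| ≤ c * |u|) : c * |u| ≤ |s + k| := by
  have := abs_add_le (s + k) (-s)
  rw [add_neg_cancel_comm, abs_neg] at this
  linarith

/-- Cones `C₁ = {2|w₁| ≤ |w₀|}` and `C₂ = {2|w₀| ≤ |w₁|}` meet only in `0`. [folklore] -/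

theorem localTubeSpan_thinCones_disjoint₀₁ (w : Fin 2 → ℚ) (h0 : |2| * |w 1| ≤ |w 0|)
    (h1 : |2| * |w 0| ≤ |w 1|) : w = 0 := by
  rw [abs_two] at h0 h1
  have e0 : |w 0| ≤ 0 := by linarith [abs_nonneg (w 0), abs_nonneg (w 1)]
  have e1 : |w 1| ≤ 0 := by linarith [abs_nonneg (w 0), abs_nonneg (w 1)]
  ext j; fin_cases j
  · exact abs_nonpos_iff.1 e0
  · exact abs_nonpos_iff.1 e1
/-- Cones `C₁ = {2|w₁| ≤ |w₀|}` and `C₃ = {4|w₀ - w₁| ≤ |w₀ + w₁|}` meet only in `0`. [folklore] -/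

theorem localTubeSpan_thinCones_disjoint₀₂ (w : Fin 2 → ℚ) (h0 : |2| * |w 1| ≤ |w 0|)
    (h2 : |(4 : ℚ)| * |w 0 - w 1| ≤ |w 0 + w 1|) : w = 0 := by
  rw [abs_two] at h0
  rw [show |(4 : ℚ)| = 4 by norm_num] at h2
  have t1 := abs_sub_abs_le_abs_sub (w 0) (w 1)
  have t2 := abs_add_le (w 0) (w 1)
  have e0 : |w 0| ≤ 0 := by linarith [abs_nonneg (w 0), abs_nonneg (w 1)]
  have e1 : |w 1| ≤ 0 := by linarith [abs_nonneg (w 0), abs_nonneg (w 1)]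
  ext j; fin_cases j
  · exact abs_nonpos_iff.1 e0
  · exact abs_nonpos_iff.1 e1
/-- Cones `C₂ = {2|w₀| ≤ |w₁|}` and `C₃ = {4|w₀ - w₁| ≤ |w₀ + w₁|}` meet only in `0`. [folklore] -/

theorem localTubeSpan_thinCones_disjoint₁₂ (w : Fin 2 → ℚ) (h1 : |2| * |w 0| ≤ |w 1|)
    (h2 : |(4 : ℚ)| * |w 0 - w 1| ≤ |w 0 + w 1|) : w = 0 := by
  rw [abs_two] at h1
  rw [show |(4 : ℚ)| = 4 by norm_num] at h2
  have t1 := abs_sub_abs_le_abs_sub (w 1) (w 0)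
  have t1' : |w 1 - w 0| = |w 0 - w 1| := abs_sub_comm _ _
  have t2 := abs_add_le (w 0) (w 1)
  have e1 : |w 1| ≤ 0 := by linarith [abs_nonneg (w 0), abs_nonneg (w 1)]
  have e0 : |w 0| ≤ 0 := by linarith [abs_nonneg (w 0), abs_nonneg (w 1)]
  ext j; fin_cases j
  · exact abs_nonpos_iff.1 e0
  · exact abs_nonpos_iff.1 e1
/-! ### The transvection data and determinant one -/

/-- **Integer powers of the three transvections.**  For a group acting on `ℚ²` with `τ 0, τ 1, τ 2`
acting as `T₁, T₂, T₃`: functionals `ℓ_i = (-4v₁, 4v₀, 4(v₀ - v₁))` and cycles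
`d_i = ((1,0), (0,1), (1,1))` with `ρ((τ i)^n) v = v - n ℓ_i(v) d_i` for every integer `n`
(`T_i = 1 - ℓ_i ⊗ d_i`, `ℓ_i(d_i) = 0`). [folklore] -/
theorem localTubeSpan_thin_transvectionData {G : Type} [Group G]
    (ρ : Representation ℚ G (Fin 2 → ℚ)) (τ : Fin 3 → G)
    (hτ₀ : ∀ v, ρ (τ 0) v = ![v 0 + 4 * v 1, v 1])
    (hτ₁ : ∀ v, ρ (τ 1) v = ![v 0, v 1 - 4 * v 0])
    (hτ₂ : ∀ v, ρ (τ 2) v = ![v 0 - 4 * (v 0 - v 1), v 1 - 4 * (v 0 - v 1)]) :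
    ∃ (d : Fin 3 → (Fin 2 → ℚ)) (ℓ : Fin 3 → (Fin 2 → ℚ) →ₗ[ℚ] ℚ),
      d 0 = ![1, 0] ∧ d 1 = ![0, 1] ∧ d 2 = ![1, 1] ∧
      (∀ v, ℓ 0 v = -4 * v 1) ∧ (∀ v, ℓ 1 v = 4 * v 0) ∧ (∀ v, ℓ 2 v = 4 * (v 0 - v 1)) ∧
      ∀ (i : Fin 3) (n : ℤ) (v : Fin 2 → ℚ), ρ (τ i ^ n) v = v - ((n : ℚ) * ℓ i v) • d i := by
  obtain ⟨d, hd0, hd1, hd2⟩ : ∃ d : Fin 3 → (Fin 2 → ℚ),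
      d 0 = ![1, 0] ∧ d 1 = ![0, 1] ∧ d 2 = ![1, 1] := ⟨![![1, 0], ![0, 1], ![1, 1]], rfl, rfl, rfl⟩
  obtain ⟨ℓ, hℓ0, hℓ1, hℓ2⟩ : ∃ ℓ : Fin 3 → (Fin 2 → ℚ) →ₗ[ℚ] ℚ,
      (∀ v, ℓ 0 v = -4 * v 1) ∧ (∀ v, ℓ 1 v = 4 * v 0) ∧ (∀ v, ℓ 2 v = 4 * (v 0 - v 1)) := by
    let π : Fin 2 → ((Fin 2 → ℚ) →ₗ[ℚ] ℚ) := fun j => LinearMap.proj j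
    refine ⟨![(-4 : ℚ) • π 1, (4 : ℚ) • π 0, (4 : ℚ) • (π 0 - π 1)],
      fun v => ?_, fun v => ?_, fun v => ?_⟩ <;> simp [π, mul_sub]
  have hℓd : ∀ i, ℓ i (d i) = 0 := by
    intro i
    match i with
    | 0 => simp [hℓ0, hd0]
    | 1 => simp [hℓ1, hd1]
    | 2 => simp [hℓ2, hd2]
  have hgen : ∀ i v, ρ (τ i) v = v - ℓ i v • d i := by
    intro i v
    match i with
    | 0 => rw [hτ₀, hℓ0, hd0]; ext j; fin_cases j <;> simp
    | 1 => rw [hτ₁, hℓ1, hd1]; ext j; fin_cases j <;> simp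
    | 2 => rw [hτ₂, hℓ2, hd2]; ext j; fin_cases j <;> simp
  have hinv : ∀ i v, ρ (τ i)⁻¹ v = v + ℓ i v • d i := by
    intro i v
    have h1 : ρ (τ i) (v + ℓ i v • d i) = v := by
      rw [hgen, map_add, map_smul, hℓd, smul_eq_mul, mul_zero, add_zero, add_sub_cancel_right]
    have h2 : ρ (τ i)⁻¹ (ρ (τ i) (v + ℓ i v • d i)) = v + ℓ i v • d i := by
      rw [← Module.End.mul_apply, ← map_mul, inv_mul_cancel, map_one, Module.End.one_apply]
    rw [h1] at h2
    exact h2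
  have hzpow : ∀ (i : Fin 3) (n : ℤ) (v : Fin 2 → ℚ),
      ρ (τ i ^ n) v = v - ((n : ℚ) * ℓ i v) • d i := by
    intro i n
    induction n using Int.induction_on with
    | zero => intro v; simp
    | succ k ih =>
      intro v
      rw [zpow_add_one, map_mul, Module.End.mul_apply, hgen, ih, map_sub, map_smul, hℓd,
        smul_eq_mul, mul_zero, sub_zero, sub_sub, ← add_smul]
      push_cast
      ring_nf
    | pred k ih =>
      intro v
      rw [zpow_sub_one, map_mul, Module.End.mul_apply, hinv, ih, map_add, map_smul, hℓd,
        smul_eq_mul, mul_zero, add_zero]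
      ext j
      simp only [Pi.add_apply, Pi.sub_apply, Pi.smul_apply, smul_eq_mul]
      push_cast
      ring
  exact ⟨d, ℓ, hd0, hd1, hd2, hℓ0, hℓ1, hℓ2, hzpow⟩

/-- **Determinant one**: every element of the group generated by `τ 0, τ 1, τ 2` acts on `ℚ²` with
determinant `1` (the generators act by the unimodular matrices `(1 4; 0 1)`, `(1 0; -4 1)`,
`(-3 4; -4 5)`). [folklore] -/
theorem localTubeSpan_thin_det_eq_one {G : Type} [Group G]
    (ρ : Representation ℚ G (Fin 2 → ℚ)) (τ : Fin 3 → G)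
    (hτ₀ : ∀ v, ρ (τ 0) v = ![v 0 + 4 * v 1, v 1])
    (hτ₁ : ∀ v, ρ (τ 1) v = ![v 0, v 1 - 4 * v 0])
    (hτ₂ : ∀ v, ρ (τ 2) v = ![v 0 - 4 * (v 0 - v 1), v 1 - 4 * (v 0 - v 1)]) :
    ∀ g ∈ Subgroup.closure (Set.range τ), LinearMap.det (ρ g) = 1 := by
  have hdetgen : ∀ i, LinearMap.det (ρ (τ i)) = 1 := by
    intro i
    have hmat : ∀ (Mx : Matrix (Fin 2) (Fin 2) ℚ), (∀ v, ρ (τ i) v = Mx *ᵥ v) →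
        ρ (τ i) = Matrix.toLin' Mx := fun Mx h =>
      LinearMap.ext fun v => by rw [Matrix.toLin'_apply, h]
    match i with
    | 0 =>
      rw [hmat !![1, 4; 0, 1] (fun v => by
        rw [hτ₀]; ext j; fin_cases j <;> simp [Matrix.mulVec, dotProduct, Fin.sum_univ_two]),
        LinearMap.det_toLin', Matrix.det_fin_two_of]
      norm_num
    | 1 =>
      rw [hmat !![1, 0; -4, 1] (fun v => by
        rw [hτ₁]; ext j; (fin_cases j <;> simp [Matrix.mulVec, dotProduct, Fin.sum_univ_two]);
          ring),
        LinearMap.det_toLin', Matrix.det_fin_two_of]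
      norm_num
    | 2 =>
      rw [hmat !![-3, 4; -4, 5] (fun v => by
        rw [hτ₂]; ext j; fin_cases j <;> simp [Matrix.mulVec, dotProduct, Fin.sum_univ_two]
          <;> ring),
        LinearMap.det_toLin', Matrix.det_fin_two_of]
      norm_num
  intro g hg
  induction hg using Subgroup.closure_induction with
  | mem g hg => obtain ⟨i, rfl⟩ := hg; exact hdetgen i
  | one => rw [map_one, map_one]
  | mul g h _ _ ihg ihh => rw [map_mul, map_mul, ihg, ihh, mul_one]
  | inv g _ ih =>
    have : LinearMap.det (ρ g⁻¹) * LinearMap.det (ρ g) = 1 := by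
      rw [← map_mul, ← map_mul, inv_mul_cancel, map_one, map_one]
    rwa [ih, mul_one] at this

end Summit.HodgeConjecture.HodgeConjecture.Theorems

end
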